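import Literature.MathematicalPhysics.QuantumFieldTheory.Balaban1983to89.Node00.Record13SepBgRowOfClassC1
import Literature.MathematicalPhysics.QuantumFieldTheory.Balaban1983to89.Node00.Record12BgRowHistory

/-!
# NODE 00 (YM-PLAN Track A) — STAGE 13: THE MONOTONE WINDOWED HISTORY (plan's K0 stub «monotone history», node00-def-P11's (hcomp) input) FROM THE SIGN OF THE RECORD's
# β-FUNCTIONS ON THE WINDOW BOX — `FlowStep.BetaLowerH b θ.γ (betaOfRecord₁₃ F N θ)`, `0 ≤ b` (the DAG's located AF leaf T09.F, in the currency the K2∕K3 lanes deliver) —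
# AT `θ` AND AT `θ₁₅ᶜᶜ¹ = theta13OfThm1CC1`

Cell `pub-ymgap`, seat `pub-ymgap-node00-def-K0a` (g6), FILE 13e (sequel of 13b `Record13SepBgRowOfClassC1`; feeds FILE 14b §3).  [I] = [Balaban1987RG1], [III] = [Balaban1988Convergent].

WHY.  The Stage-13 history of a run IS generated: `gOfRecord₁₃ F N θ p = genSeq (betaOfRecord₁₃ F N θ) p.g0` (`abbrev`, `Record13` §1; [I] (0.17)–(0.20)).  So the run guard
(hmono) «`g_m ≤ g_{m+1}` along every windowed run» that node00-def-P11's comparable-threshold clause (hcomp) needs (FILE 11c∕13b `hcomp_…_of_monotone`; [III] (2.6)–(2.8)) is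
ONE STEP of (0.20) with `β ≥ 0` — `B15Claim189N0OfRecord.genSeq_le_succ_of_beta_nonneg` — and `β ≥ 0` along a windowed history is the box lower bound `FlowStep.BetaLowerH b γ β`,
`0 ≤ b`, at the prefixes (`B15Claim189N0OfRecord.betaAlongHistory_nonneg_of_betaLowerH`).  Hence plan's third K0 stub is, BY NAME, the sign∕AF leaf of the record's β₁₃ at the
witness — the hypothesis shape of `FlowStepRuns` (cell DAG headline inputs `BetaLowerH b γ₀ β`), not a free-standing monotonicity claim.

WHAT THIS FILE PROVES (theorems only; 0 `def`).
* §1 ★ `Stage13Params.hmono_of_betaLowerH (θ) (hb : 0 ≤ b) (hlow : FlowStep.BetaLowerH b θ.γ (betaOfRecord₁₃ F N θ))` : (hmono) at `θ`; `Stage13Params.hmono_of_betaSign` (`b = 0`).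
* §2 at `θ₁₅ᶜᶜ¹`: `hmono_theta13OfThm1CC1_of_betaLowerH`, ★ `hcomp_theta13OfThm1CC1_of_betaLowerH` (node00-def-P11's (hcomp) ⟸ the β-sign leaf, via FILE 13b §2 `hcomp_theta13OfThm1CC1_of_monotone`).

HONEST FRAMING.  Composition of tree lemmas; CONDITIONAL on the DISPLAYED β-sign hypothesis `FlowStep.BetaLowerH b γ β₁₃` (the located UNPRINTED input T09.F of the cell's DAG — [I]
p.264 defers the β-function properties; NEVER asserted here); nothing of Bałaban asserted; NOT a discharge; K0 NOT closed; counts unmoved (typed 28∕28 · discharged 5∕28); one finite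
𝕋⁴ programme at fixed ε — NOT continuum ∕ OS ∕ mass gap ∕ Clay.  No `sorry`, `axiom`, `def`, `instance`, `notation`.
-/

noncomputable section

open MeasureTheory
open scoped Matrix.Norms.L2Operator

namespace Literature.MathematicalPhysics.QuantumFieldTheory.Balaban1983to89.Node00

open T4Continuum B14.Eq218Concrete B15DeterminingSets FlowStep FlowStepRuns
open B15Claim189N0OfRecord (genSeq_le_succ_of_beta_nonneg betaAlongHistory_nonneg_of_betaLowerH)

/-! ## §1. (hmono) at a generic Stage-13 parameter from the β-sign on the window box -/

section Generic

variable {F : T4Family} {N : ℕ} [NeZero N]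

/-- **★ THE WINDOWED HISTORY OF EVERY RUN IS NON-DECREASING WHEN THE RECORD's β-FUNCTIONS ARE BOUNDED BELOW BY `b ≥ 0` ON THE WINDOW BOX**: for `n ≤ K`, a history in
`]0, θ.γ]` up to `n` and `m < n`, `g_m ≤ g_{m+1}` — one step of (0.20) (`g_{m+1}⁻² = g_m⁻² − β_m(g_0,…,g_m)`) with `β_m ≥ b ≥ 0` at the prefix (in the box by the window).
CONDITIONAL on `BetaLowerH`; nothing of Bałaban asserted. [cite: Balaban1987RG1, (0.20) p.256, Thm 2 p.259, §1 p.264; Balaban1988Convergent, (2.6) p.255] -/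
theorem Stage13Params.hmono_of_betaLowerH (θ : Stage13Params F N) {b : ℝ} (hb : 0 ≤ b) (hlow : BetaLowerH b θ.γ (betaOfRecord₁₃ F N θ)) :
    ∀ (p : B12.RunParams) (n : ℕ), n ≤ p.K → Step.InInterval θ.γ n (gOfRecord₁₃ F N θ p) → ∀ m, m < n →
      gOfRecord₁₃ F N θ p m ≤ gOfRecord₁₃ F N θ p (m + 1) :=
  fun p _ _ hw m hm =>
    genSeq_le_succ_of_beta_nonneg (betaOfRecord₁₃ F N θ) p.g0 (hw m hm.le).1 (hw (m + 1) hm).1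
      (betaAlongHistory_nonneg_of_betaLowerH hb hlow hw m hm)

/-- **… in particular from the SIGN `β ≥ 0` on the window box** (`b = 0`; the DAG leaf `betaPositive` in its history-dependent form). [cite: Balaban1987RG1, (0.20) p.256, §1 p.264; Balaban1988Convergent, (2.6) p.255] -/
theorem Stage13Params.hmono_of_betaSign (θ : Stage13Params F N) (hsign : BetaLowerH 0 θ.γ (betaOfRecord₁₃ F N θ)) :
    ∀ (p : B12.RunParams) (n : ℕ), n ≤ p.K → Step.InInterval θ.γ n (gOfRecord₁₃ F N θ p) → ∀ m, m < n →
      gOfRecord₁₃ F N θ p m ≤ gOfRecord₁₃ F N θ p (m + 1) :=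
  θ.hmono_of_betaLowerH le_rfl hsign

end Generic

/-! ## §2. At `θ₁₅ᶜᶜ¹`: (hmono) and node00-def-P11's (hcomp) from the β-sign leaf -/

section AtWitness

variable {F : T4Family} {N : ℕ} [NeZero N] {ε₀ ε₂₉ B₃ B₃' a₀ a₁ : ℝ}

/-- **(hmono) AT `θ₁₅ᶜᶜ¹` from `BetaLowerH b ½ β₁₃(θ₁₅ᶜᶜ¹)`, `0 ≤ b`** (`θ₁₅ᶜᶜ¹.γ = ½`). [cite: Balaban1987RG1, (0.20) p.256, §1 p.264; Balaban1988Convergent, (2.6) p.255] -/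
theorem hmono_theta13OfThm1CC1_of_betaLowerH {b : ℝ} (hb : 0 ≤ b) (hlow : BetaLowerH b (1 / 2) (betaOfRecord₁₃ F N (theta13OfThm1CC1 F N ε₀ ε₂₉ B₃ B₃' a₀ a₁))) :
    ∀ (p : B12.RunParams) (n : ℕ), n ≤ p.K → Step.InInterval (theta13OfThm1CC1 F N ε₀ ε₂₉ B₃ B₃' a₀ a₁).γ n (gOfRecord₁₃ F N (theta13OfThm1CC1 F N ε₀ ε₂₉ B₃ B₃' a₀ a₁) p) → ∀ m, m < n →
      gOfRecord₁₃ F N (theta13OfThm1CC1 F N ε₀ ε₂₉ B₃ B₃' a₀ a₁) p m ≤ gOfRecord₁₃ F N (theta13OfThm1CC1 F N ε₀ ε₂₉ B₃ B₃' a₀ a₁) p (m + 1) :=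
  (theta13OfThm1CC1 F N ε₀ ε₂₉ B₃ B₃' a₀ a₁).hmono_of_betaLowerH hb ((theta13OfThm1CC1_γ F N ε₀ ε₂₉ B₃ B₃' a₀ a₁).symm ▸ hlow)

/-- **★ node00-def-P11's (hcomp) AT `θ₁₅ᶜᶜ¹` FROM THE β-SIGN LEAF** — `cR·ε_m ≤ 2·cR·ε_{m+1}` along every windowed run, by FILE 13b §2 `hcomp_theta13OfThm1CC1_of_monotone` ∘ §2's
(hmono): the comparable-threshold clause of [III] (2.7)–(2.8) at the witness ⟸ `BetaLowerH b ½ β₁₃(θ₁₅ᶜᶜ¹)`, `0 ≤ b`, and the weak signs of the class constants. [cite: Balaban1988Convergent, (2.4) p.255, (2.6)–(2.8) pp.255–256; Balaban1987RG1, (0.20) p.256, §1 p.264] -/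
theorem hcomp_theta13OfThm1CC1_of_betaLowerH (hB : 0 ≤ B₃) (hB' : 0 ≤ B₃') (ha₀ : 0 ≤ a₀) (ha₁ : 0 ≤ a₁)
    {b : ℝ} (hb : 0 ≤ b) (hlow : BetaLowerH b (1 / 2) (betaOfRecord₁₃ F N (theta13OfThm1CC1 F N ε₀ ε₂₉ B₃ B₃' a₀ a₁))) :
    ∀ (p : B12.RunParams) (n : ℕ), n ≤ p.K → Step.InInterval (theta13OfThm1CC1 F N ε₀ ε₂₉ B₃ B₃' a₀ a₁).γ n (gOfRecord₁₃ F N (theta13OfThm1CC1 F N ε₀ ε₂₉ B₃ B₃' a₀ a₁) p) → ∀ m, m < n →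
      (theta13OfThm1CC1 F N ε₀ ε₂₉ B₃ B₃' a₀ a₁).s2.cR * epsOfRecord (theta13OfThm1CC1 F N ε₀ ε₂₉ B₃ B₃' a₀ a₁).ν (gOfRecord₁₃ F N (theta13OfThm1CC1 F N ε₀ ε₂₉ B₃ B₃' a₀ a₁) p) m ≤ 2 * ((theta13OfThm1CC1 F N ε₀ ε₂₉ B₃ B₃' a₀ a₁).s2.cR * epsOfRecord (theta13OfThm1CC1 F N ε₀ ε₂₉ B₃ B₃' a₀ a₁).ν (gOfRecord₁₃ F N (theta13OfThm1CC1 F N ε₀ ε₂₉ B₃ B₃' a₀ a₁) p) (m + 1)) :=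
  hcomp_theta13OfThm1CC1_of_monotone hB hB' ha₀ ha₁ (hmono_theta13OfThm1CC1_of_betaLowerH hb hlow)

end AtWitness

end Literature.MathematicalPhysics.QuantumFieldTheory.Balaban1983to89.Node00

end
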